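import Mathlib
import Summits.CriticalPhenomena.PercolationContinuityZ3.Theorems.PercNearOneGluingNoHeavyLowerTailThreeFamilyTripleHall

/-!
# TRIPLE⁻: the outer families of a three-family system are rigid — two double-difference blocks suffice

Helper file for crux `stmt-CriticalPhenomena-4575` (`NoHeavyLowerTail`, route `PercNearOneGluingNoHeavy`),
new-inequality factory seat `prim-ineq-gen-3` (gen 10).  Everything here is PROVED.

**Theorem TRIPLE⁻-0 (hypothesis-free, `triple0_minus`).**  `P, Q, R` arbitrary families of subsets of `S`,
`κ_P, κ_Q, κ_R` supported on them, `G` ANY down-closed family in `S` containing `P \\ P`, `R \\ R`, `P ⊼ Q`, `Q ⊼ R`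
and the two OUTER double-difference blocks `{X \ (Y ∪ Z)}`, `{Z \ (X ∪ Y)}` (`X ∈ P`, `Y ∈ Q`, `Z ∈ R`).  If the three
moment functions `E ↦ Σ_{U ⊇ E} κ_T(U)` agree on `G`, then `κ_P = κ_R`.  (The middle block `{Y \ (X ∪ Z)}`, `Q \\ Q`
and `P ⊼ R` of TRIPLE-0, gen 9, are not needed; TRIPLE-0 = TRIPLE⁻-0 for `(P,Q,R)` and `(Q,R,P)`.)
Proof: induction on `S` by one-point push-forwards as for TRIPLE-0 (`κ_P − κ_R = a·(−1)^{#U}`, `a ≠ 0` forces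
`P ∪ R = 2^S`); new final step (`residual_aux`): if `S ∈ P`, `∅ ∈ R`, every member of `Q` (`= S ∩ Y`) and of `R`
(`= Z \ ∅`) lies in `G`, so off `G` the `Q`- and `R`-moments both vanish; they agree on all of `2^S`, `κ_Q = κ_R` by
Möbius inversion, and at `∅` (`∅ ∉ Q`, else `S = S \ (∅ ∪ ∅) ∈ G`) `κ_P(∅) = a ≠ 0`, so `∅ ∈ P`, `S = S \ ∅ ∈ G`.

Consequences: `V_P ⊓ V_Q ⊓ V_R = ⊥` in `ℚ^G` whenever no set lies in both `P` and `R`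
(`V_inf_V_inf_V_eq_bot_of_blocks`); with Theorem A′ (p223892) the count `#P + #Q + #R ≤ #G` for pairwise
cross-intersecting families with `P ∩ R = ∅` (`card_add_card_add_card_le_of_blocks`) — exactly what the capacity-one
Hall count for the TRANSITIVE orientation selections needs (file `…OrientedAntipodalHallTransitive`).  Census before
the proof (lab10/): `κ_P = κ_R` in 7·10⁵ hypothesis-free random instances, both outer blocks necessary
(memo `run/shared/lean/prim/prim-ineq-gen-3/PROOF-TRIPLEMINUS.md`; prim-ineq-gen-3 gen 10, 2026-08-20).
-/

namespace Summit.CriticalPhenomena.PercolationContinuityZ3.Theorems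

namespace ThreeFamilyRank

open Finset Module
open scoped FinsetFamily

variable {α : Type*} [DecidableEq α]

/-- Moments are additive: the moment of a difference of two functions. -/
theorem mom_sub (S : Finset α) (κ κ' : Finset α → ℚ) (E : Finset α) :
    mom S (fun U => κ U - κ' U) E = mom S κ E - mom S κ' E := by
  unfold mom
  rw [← Finset.sum_sub_distrib]
  refine Finset.sum_congr rfl fun U _ => ?_
  split_ifs <;> simp

/-- If no superset of `E` inside `S` carries mass, the moment of `E` vanishes. -/
theorem mom_eq_zero_of_superset (S : Finset α) (κ : Finset α → ℚ) (E : Finset α)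
    (h : ∀ U, U ⊆ S → E ⊆ U → κ U = 0) : mom S κ E = 0 := by
  unfold mom
  apply Finset.sum_eq_zero
  intro U hU
  split_ifs with hEU
  · exact h U (Finset.mem_powerset.mp hU) hEU
  · rfl

/-- Möbius injectivity: a function supported inside `2^S` all of whose moments over `S` vanish is zero. -/
theorem eq_zero_of_mom_eq_zero (S : Finset α) (δ : Finset α → ℚ) (hδ : ∀ U, ¬ U ⊆ S → δ U = 0)
    (hmom : ∀ E, E ⊆ S → mom S δ E = 0) : δ = 0 := by
  by_contra hne
  have hex : ∃ U, δ U ≠ 0 := by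
    by_contra h
    push Not at h
    exact hne (funext h)
  obtain ⟨U₁, hU₁⟩ := hex
  have hU₁S : U₁ ⊆ S := by by_contra h; exact hU₁ (hδ U₁ h)
  set F : Finset (Finset α) := S.powerset.filter (fun U => δ U ≠ 0) with hF
  have hFne : F.Nonempty := ⟨U₁, by rw [hF, Finset.mem_filter, Finset.mem_powerset]; exact ⟨hU₁S, hU₁⟩⟩
  -- a set of maximal cardinality carrying mass
  obtain ⟨U₀, hU₀F, hmax⟩ := Finset.exists_max_image F (fun U => #U) hFne
  rw [hF, Finset.mem_filter, Finset.mem_powerset] at hU₀F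
  obtain ⟨hU₀S, hU₀⟩ := hU₀F
  have h := hmom U₀ hU₀S
  unfold mom at h
  rw [Finset.sum_eq_single U₀] at h
  · rw [if_pos subset_rfl] at h
    exact hU₀ h
  · intro U hU hUne
    split_ifs with hsub
    · by_contra hδU
      have hUF : U ∈ F := by rw [hF, Finset.mem_filter]; exact ⟨hU, hδU⟩
      have hlt : #U₀ < #U := Finset.card_lt_card (lt_of_le_of_ne hsub (Ne.symm hUne))
      exact absurd (hmax U hUF) (not_le.mpr hlt)
    · rfl
  · exact fun h0 => absurd (Finset.mem_powerset.mpr hU₀S) h0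

/-- **The final step of TRIPLE⁻-0.**  Three families `A, B, C` in `S` with functions `κ_A, κ_B, κ_C`; `G` down-closed
with `S ∉ G`; `κ_A − κ_C = a·(−1)^{#U}` on `2^S`; `S ∈ A`, all differences `A \\ A` in `G`, every member of `B` and
of `C` in `G`, `∅ ∉ B`, and the `B`- and `C`-moments agree on `G`.  Then `a = 0`.  (For `E ∉ G` no member of `B ∪ C`
contains `E`, so the `B`- and `C`-moments agree everywhere; hence `κ_B = κ_C`, `κ_C ∅ = κ_B ∅ = 0`, `κ_A ∅ = a`, and
`a ≠ 0` would put `∅` into `A` and `S = S \ ∅` into `G`.) -/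
theorem residual_aux (S : Finset α) (G A B C : Finset (Finset α)) (κA κB κC : Finset α → ℚ) (a : ℚ)
    (hG : ∀ E ∈ G, ∀ F, F ⊆ E → F ∈ G)
    (hBS : ∀ U ∈ B, U ⊆ S) (hCS : ∀ U ∈ C, U ⊆ S)
    (sA : ∀ U, U ∉ A → κA U = 0) (sB : ∀ U, U ∉ B → κB U = 0) (sC : ∀ U, U ∉ C → κC U = 0)
    (hmom : ∀ E ∈ G, mom S κB E = mom S κC E)
    (halt : ∀ U, U ⊆ S → κA U - κC U = (-1 : ℚ) ^ #U * a)
    (hSA : S ∈ A) (hSG : S ∉ G)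
    (hAA : ∀ X ∈ A, ∀ X' ∈ A, X \ X' ∈ G) (hBG : ∀ Y ∈ B, Y ∈ G) (hCG : ∀ Z ∈ C, Z ∈ G)
    (h0B : ∅ ∉ B) : a = 0 := by
  -- the `B`- and `C`-moments agree on all of `2^S`
  have key : ∀ E, E ⊆ S → mom S κB E = mom S κC E := by
    intro E _
    by_cases hEG : E ∈ G
    · exact hmom E hEG
    · rw [mom_eq_zero_of_superset S κB E fun U _ hEU => sB U fun hUB => hEG (hG U (hBG U hUB) E hEU),
        mom_eq_zero_of_superset S κC E fun U _ hEU => sC U fun hUC => hEG (hG U (hCG U hUC) E hEU)]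
  -- hence `κ_B = κ_C`
  have hBC : (fun U => κB U - κC U) = 0 := by
    apply eq_zero_of_mom_eq_zero S
    · intro U hU
      have h1 : κB U = 0 := sB U fun h => hU (hBS U h)
      have h2 : κC U = 0 := sC U fun h => hU (hCS U h)
      simp only [h1, h2, sub_self]
    · intro E hE
      rw [mom_sub, key E hE, sub_self]
  have hC0 : κC ∅ = 0 := by
    have h := congrFun hBC ∅
    simp only [Pi.zero_apply] at h
    rw [sB ∅ h0B] at h
    linarith
  have hA0 : κA ∅ = a := by
    have h := halt ∅ (Finset.empty_subset S)
    rw [hC0, Finset.card_empty, pow_zero, one_mul, sub_zero] at h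
    exact h
  by_contra ha
  have h0A : ∅ ∈ A := by by_contra h; exact ha (by rw [← hA0, sA ∅ h])
  apply hSG
  have h := hAA S hSA ∅ h0A
  rwa [Finset.sdiff_empty] at h

/-- `A.erase w \ B.erase w ⊆ A \ B`. -/
theorem erase_sdiff_erase_subset (w : α) (A B : Finset α) : A.erase w \ B.erase w ⊆ A \ B := by
  intro x hx
  simp only [Finset.mem_sdiff, Finset.mem_erase] at hx ⊢
  exact ⟨hx.1.2, fun hB => hx.2 ⟨hx.1.1, hB⟩⟩

/-- `A.erase w ∩ B.erase w ⊆ A ∩ B`. -/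
theorem erase_inter_erase_subset (w : α) (A B : Finset α) : A.erase w ∩ B.erase w ⊆ A ∩ B := by
  intro x hx
  simp only [Finset.mem_inter, Finset.mem_erase] at hx ⊢
  exact ⟨hx.1.2, hx.2.2⟩

/-- `A.erase w \ (B.erase w ∪ C.erase w) ⊆ A \ (B ∪ C)`. -/
theorem erase_sdiff_union_erase_subset (w : α) (A B C : Finset α) :
    A.erase w \ (B.erase w ∪ C.erase w) ⊆ A \ (B ∪ C) := by
  intro x hx
  simp only [Finset.mem_sdiff, Finset.mem_erase, Finset.mem_union, not_or] at hx ⊢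
  exact ⟨hx.1.2, fun hB => hx.2.1 ⟨hx.1.1, hB⟩, fun hC => hx.2.2 ⟨hx.1.1, hC⟩⟩

/-- `w ∉ A.erase w \ T`. -/
theorem not_mem_erase_sdiff (w : α) (A T : Finset α) : w ∉ A.erase w \ T :=
  fun h => (Finset.notMem_erase w A) (Finset.mem_sdiff.mp h).1

/-- `w ∉ A.erase w ∩ T`. -/
theorem not_mem_erase_inter (w : α) (A T : Finset α) : w ∉ A.erase w ∩ T :=
  fun h => (Finset.notMem_erase w A) (Finset.mem_inter.mp h).1

/-- **TRIPLE⁻-0 (hypothesis-free).**  Let `P, Q, R` be arbitrary families of subsets of `S`, `κ_P, κ_Q, κ_R`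
functions supported on them, and `G` a down-closed family of subsets of `S` containing `P \\ P`, `R \\ R`,
`P ⊼ Q`, `Q ⊼ R` and the outer double differences `X \ (Y ∪ Z)`, `Z \ (X ∪ Y)` (`X ∈ P`, `Y ∈ Q`, `Z ∈ R`).
If the three moment functions agree on `G`, then `κ_P = κ_R`. -/
theorem triple0_minus (S : Finset α) :
    ∀ (G P Q R : Finset (Finset α)) (κP κQ κR : Finset α → ℚ),
    (∀ E ∈ G, E ⊆ S) → (∀ E ∈ G, ∀ F, F ⊆ E → F ∈ G) →
    (∀ U ∈ P, U ⊆ S) → (∀ U ∈ Q, U ⊆ S) → (∀ U ∈ R, U ⊆ S) →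
    (∀ U, U ∉ P → κP U = 0) → (∀ U, U ∉ Q → κQ U = 0) → (∀ U, U ∉ R → κR U = 0) →
    (∀ X ∈ P, ∀ X' ∈ P, X \ X' ∈ G) → (∀ Z ∈ R, ∀ Z' ∈ R, Z \ Z' ∈ G) →
    (∀ X ∈ P, ∀ Y ∈ Q, X ∩ Y ∈ G) → (∀ Y ∈ Q, ∀ Z ∈ R, Y ∩ Z ∈ G) →
    (∀ X ∈ P, ∀ Y ∈ Q, ∀ Z ∈ R, X \ (Y ∪ Z) ∈ G) →
    (∀ X ∈ P, ∀ Y ∈ Q, ∀ Z ∈ R, Z \ (X ∪ Y) ∈ G) →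
    (∀ E ∈ G, mom S κP E = mom S κQ E ∧ mom S κQ E = mom S κR E) →
    κP = κR := by
  induction S using Finset.strongInduction with
  | H S ih =>
  intro G P Q R κP κQ κR hGS hG hPS hQS hRS sP sQ sR hPP hRR hPQ hQR hDDP hDDR hmom
  -- Step 1: the pushed instances along every point `w ∈ S`
  have hpush : ∀ w ∈ S, push w κP = push w κR := by
    intro w hw
    have hwS : w ∉ S.erase w := Finset.notMem_erase w S
    have hins : insert w (S.erase w) = S := Finset.insert_erase hw
    have himS : ∀ T : Finset (Finset α), (∀ U ∈ T, U ⊆ S) →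
        ∀ U ∈ T.image (fun U => U.erase w), U ⊆ S.erase w := by
      intro T hT U hU
      obtain ⟨U0, hU0, rfl⟩ := Finset.mem_image.mp hU
      exact Finset.erase_subset_erase w (hT U0 hU0)
    -- the restricted family `G' = {E ∈ G : w ∉ E}`
    have hG'S : ∀ E ∈ G.filter (fun E => w ∉ E), E ⊆ S.erase w := by
      intro E hE
      obtain ⟨hEG, hwE⟩ := Finset.mem_filter.mp hE
      intro x hx
      exact Finset.mem_erase.mpr ⟨fun hxw => hwE (hxw ▸ hx), hGS E hEG hx⟩
    have hG'down : ∀ E ∈ G.filter (fun E => w ∉ E), ∀ F, F ⊆ E → F ∈ G.filter (fun E => w ∉ E) := by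
      intro E hE F hFE
      obtain ⟨hEG, hwE⟩ := Finset.mem_filter.mp hE
      exact Finset.mem_filter.mpr ⟨hG E hEG F hFE, fun hwF => hwE (hFE hwF)⟩
    have mem_G' : ∀ {T T' : Finset α}, T ∈ G → T' ⊆ T → w ∉ T' → T' ∈ G.filter (fun E => w ∉ E) :=
      fun hT hT'T hwT' => Finset.mem_filter.mpr ⟨hG _ hT _ hT'T, hwT'⟩
    refine ih (S.erase w) (Finset.erase_ssubset hw) (G.filter fun E => w ∉ E)
      (P.image fun U => U.erase w) (Q.image fun U => U.erase w) (R.image fun U => U.erase w)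
      (push w κP) (push w κQ) (push w κR) hG'S hG'down (himS P hPS) (himS Q hQS) (himS R hRS)
      (fun U hU => push_eq_zero_of_not_mem sP hU) (fun U hU => push_eq_zero_of_not_mem sQ hU)
      (fun U hU => push_eq_zero_of_not_mem sR hU) ?_ ?_ ?_ ?_ ?_ ?_ ?_
    · intro X hX X' hX'
      obtain ⟨X0, hX0, rfl⟩ := Finset.mem_image.mp hX
      obtain ⟨X1, hX1, rfl⟩ := Finset.mem_image.mp hX'
      exact mem_G' (hPP X0 hX0 X1 hX1) (erase_sdiff_erase_subset w X0 X1) (not_mem_erase_sdiff w X0 _)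
    · intro Z hZ Z' hZ'
      obtain ⟨Z0, hZ0, rfl⟩ := Finset.mem_image.mp hZ
      obtain ⟨Z1, hZ1, rfl⟩ := Finset.mem_image.mp hZ'
      exact mem_G' (hRR Z0 hZ0 Z1 hZ1) (erase_sdiff_erase_subset w Z0 Z1) (not_mem_erase_sdiff w Z0 _)
    · intro X hX Y hY
      obtain ⟨X0, hX0, rfl⟩ := Finset.mem_image.mp hX
      obtain ⟨Y0, hY0, rfl⟩ := Finset.mem_image.mp hY
      exact mem_G' (hPQ X0 hX0 Y0 hY0) (erase_inter_erase_subset w X0 Y0) (not_mem_erase_inter w X0 _)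
    · intro Y hY Z hZ
      obtain ⟨Y0, hY0, rfl⟩ := Finset.mem_image.mp hY
      obtain ⟨Z0, hZ0, rfl⟩ := Finset.mem_image.mp hZ
      exact mem_G' (hQR Y0 hY0 Z0 hZ0) (erase_inter_erase_subset w Y0 Z0) (not_mem_erase_inter w Y0 _)
    · intro X hX Y hY Z hZ
      obtain ⟨X0, hX0, rfl⟩ := Finset.mem_image.mp hX
      obtain ⟨Y0, hY0, rfl⟩ := Finset.mem_image.mp hY
      obtain ⟨Z0, hZ0, rfl⟩ := Finset.mem_image.mp hZ
      exact mem_G' (hDDP X0 hX0 Y0 hY0 Z0 hZ0) (erase_sdiff_union_erase_subset w X0 Y0 Z0)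
        (not_mem_erase_sdiff w X0 _)
    · intro X hX Y hY Z hZ
      obtain ⟨X0, hX0, rfl⟩ := Finset.mem_image.mp hX
      obtain ⟨Y0, hY0, rfl⟩ := Finset.mem_image.mp hY
      obtain ⟨Z0, hZ0, rfl⟩ := Finset.mem_image.mp hZ
      exact mem_G' (hDDR X0 hX0 Y0 hY0 Z0 hZ0) (erase_sdiff_union_erase_subset w Z0 X0 Y0)
        (not_mem_erase_sdiff w Z0 _)
    · intro E hE
      obtain ⟨hEG, hwE⟩ := Finset.mem_filter.mp hE
      rw [mom_push (S.erase w) hwS κP hwE, mom_push (S.erase w) hwS κQ hwE,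
        mom_push (S.erase w) hwS κR hwE, hins]
      exact hmom E hEG
  -- Step 2: the difference `κ_P − κ_R` alternates
  set d : Finset α → ℚ := fun U => κP U - κR U with hd
  have alt : ∀ U : Finset α, U ⊆ S → d U = (-1 : ℚ) ^ #U * d ∅ := by
    apply eq_sign_mul_of_alternating
    intro w hw T hwT _
    have h := congrFun (hpush w hw) T
    simp only [push, hwT, if_false] at h
    simp only [hd]; linarith
  have hsign : ∀ U : Finset α, ((-1 : ℚ) ^ #U) ≠ 0 := fun U => pow_ne_zero _ (by norm_num)
  -- Step 3: the constant vanishes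
  have main : d ∅ = 0 := by
    by_cases hSG : S ∈ G
    · obtain ⟨h1, h2⟩ := hmom S hSG
      rw [mom_self, mom_self] at h1 h2
      have e : d S = 0 := by simp only [hd, h1, h2, sub_self]
      rw [alt S subset_rfl] at e
      exact (mul_eq_zero.mp e).resolve_left (hsign S)
    · by_contra hne
      -- every subset of `S` lies in `P ∪ R`
      have cover : ∀ U, U ⊆ S → U ∈ P ∨ U ∈ R := by
        intro U hU
        by_contra hc
        rw [not_or] at hc
        have h0 : d U = 0 := by simp only [hd, sP U hc.1, sR U hc.2, sub_zero]
        rw [alt U hU] at h0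
        exact hne ((mul_eq_zero.mp h0).resolve_left (hsign U))
      have eS : (∅ : Finset α) ⊆ S := Finset.empty_subset S
      rcases cover S subset_rfl with hSP | hSR <;> rcases cover ∅ eS with h0P | h0R
      · -- `S, ∅ ∈ P`: `S = S \ ∅ ∈ G`
        apply hSG
        have h := hPP S hSP ∅ h0P
        rwa [Finset.sdiff_empty] at h
      · -- `S ∈ P`, `∅ ∈ R`: the residual step with `A = P`, `B = Q`, `C = R`
        have hCG : ∀ Z ∈ R, Z ∈ G := by
          intro Z hZ
          have h := hRR Z hZ ∅ h0R
          rwa [Finset.sdiff_empty] at h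
        have hBG : ∀ Y ∈ Q, Y ∈ G := by
          intro Y hY
          have h := hPQ S hSP Y hY
          rwa [Finset.inter_eq_right.mpr (hQS Y hY)] at h
        have h0B : ∅ ∉ Q := by
          intro h0Q
          apply hSG
          have h := hDDP S hSP ∅ h0Q ∅ h0R
          rwa [Finset.union_empty, Finset.sdiff_empty] at h
        exact hne (residual_aux S G P Q R κP κQ κR (d ∅) hG hQS hRS sP sQ sR
          (fun E hE => (hmom E hE).2) (fun U hU => alt U hU) hSP hSG hPP hBG hCG h0B)
      · -- `S ∈ R`, `∅ ∈ P`: the residual step with `A = R`, `B = Q`, `C = P`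
        have hCG : ∀ X ∈ P, X ∈ G := by
          intro X hX
          have h := hPP X hX ∅ h0P
          rwa [Finset.sdiff_empty] at h
        have hBG : ∀ Y ∈ Q, Y ∈ G := by
          intro Y hY
          have h := hQR Y hY S hSR
          rwa [Finset.inter_eq_left.mpr (hQS Y hY)] at h
        have h0B : ∅ ∉ Q := by
          intro h0Q
          apply hSG
          have h := hDDR ∅ h0P ∅ h0Q S hSR
          rwa [Finset.union_empty, Finset.sdiff_empty] at h
        have halt' : ∀ U, U ⊆ S → κR U - κP U = (-1 : ℚ) ^ #U * (-(d ∅)) := by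
          intro U hU
          have h := alt U hU
          simp only [hd] at h
          linarith
        have h := residual_aux S G R Q P κR κQ κP (-(d ∅)) hG hQS hPS sR sQ sP
          (fun E hE => (hmom E hE).1.symm) halt' hSR hSG hRR hBG hCG h0B
        exact hne (neg_eq_zero.mp h)
      · -- `S, ∅ ∈ R`
        apply hSG
        have h := hRR S hSR ∅ h0R
        rwa [Finset.sdiff_empty] at h
  -- Step 4: conclude
  funext U
  by_cases hU : U ⊆ S
  · have h := alt U hU
    rw [main, mul_zero] at h
    simpa only [hd, sub_eq_zero] using h
  · have hUP : U ∉ P := fun h => hU (hPS U h)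
    have hUR : U ∉ R := fun h => hU (hRS U h)
    rw [sP U hUP, sR U hUR]

/-- A vector of the span `V G T` is the moment vector of a function supported on `T`. -/
theorem exists_kappa_of_mem_V (S : Finset α) (G T : Finset (Finset α)) (hTS : ∀ U ∈ T, U ⊆ S)
    {v : Vec G} (hv : v ∈ V G T) :
    ∃ κ : Finset α → ℚ, (∀ U, U ∉ T → κ U = 0) ∧ ∀ E : ↥G, v E = mom S κ (E : Finset α) := by
  rw [V, Submodule.mem_span_range_iff_exists_fun] at hv
  obtain ⟨c, hc⟩ := hv
  refine ⟨fun U => if h : U ∈ T then c ⟨U, h⟩ else 0, fun U hU => by simp [hU], fun E => ?_⟩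
  rw [← hc, mom_eq_sum S hTS _ (fun U hU => by simp [hU])]
  rw [Finset.sum_apply]
  simp only [Pi.smul_apply, smul_eq_mul, chi]
  rw [← Finset.sum_coe_sort T (fun U => if (E : Finset α) ⊆ U then
      (if h : U ∈ T then c ⟨U, h⟩ else 0) else 0)]
  refine Finset.sum_congr rfl fun i _ => ?_
  have hi : (i : Finset α) ∈ T := i.2
  by_cases hE : (E : Finset α) ⊆ (i : Finset α) <;> simp [hE, hi]

/-- **TRIPLE⁻.**  For three families of subsets of `S` with no set lying in both OUTER families `P` and `R`, and a
down-closed `G` in `S` containing `P \\ P`, `R \\ R`, `P ⊼ Q`, `Q ⊼ R` and the outer double differences, the spans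
of the plain vectors in `ℚ^G` have trivial triple intersection. -/
theorem V_inf_V_inf_V_eq_bot_of_blocks (S : Finset α) (G P Q R : Finset (Finset α))
    (hGS : ∀ E ∈ G, E ⊆ S) (hG : ∀ E ∈ G, ∀ F, F ⊆ E → F ∈ G)
    (hPS : ∀ U ∈ P, U ⊆ S) (hQS : ∀ U ∈ Q, U ⊆ S) (hRS : ∀ U ∈ R, U ⊆ S)
    (hPP : ∀ X ∈ P, ∀ X' ∈ P, X \ X' ∈ G) (hRR : ∀ Z ∈ R, ∀ Z' ∈ R, Z \ Z' ∈ G)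
    (hPQ : ∀ X ∈ P, ∀ Y ∈ Q, X ∩ Y ∈ G) (hQR : ∀ Y ∈ Q, ∀ Z ∈ R, Y ∩ Z ∈ G)
    (hDDP : ∀ X ∈ P, ∀ Y ∈ Q, ∀ Z ∈ R, X \ (Y ∪ Z) ∈ G)
    (hDDR : ∀ X ∈ P, ∀ Y ∈ Q, ∀ Z ∈ R, Z \ (X ∪ Y) ∈ G)
    (hdisj : ∀ U ∈ P, U ∉ R) :
    V G P ⊓ V G Q ⊓ V G R = ⊥ := by
  rw [Submodule.eq_bot_iff]
  intro v hv
  rw [Submodule.mem_inf, Submodule.mem_inf] at hv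
  obtain ⟨⟨hvP, hvQ⟩, hvR⟩ := hv
  obtain ⟨κP, sP, hP⟩ := exists_kappa_of_mem_V S G P hPS hvP
  obtain ⟨κQ, sQ, hQ⟩ := exists_kappa_of_mem_V S G Q hQS hvQ
  obtain ⟨κR, sR, hR⟩ := exists_kappa_of_mem_V S G R hRS hvR
  have hmom : ∀ E ∈ G, mom S κP E = mom S κQ E ∧ mom S κQ E = mom S κR E := by
    intro E hE
    have e1 := hP ⟨E, hE⟩; have e2 := hQ ⟨E, hE⟩; have e3 := hR ⟨E, hE⟩
    exact ⟨e1.symm.trans e2, e2.symm.trans e3⟩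
  have hPR := triple0_minus S G P Q R κP κQ κR hGS hG hPS hQS hRS sP sQ sR hPP hRR hPQ hQR hDDP hDDR
    hmom
  have hzero : ∀ U, κP U = 0 := by
    intro U
    by_cases h1 : U ∈ P
    · rw [hPR]; exact sR U (hdisj U h1)
    · exact sP U h1
  funext E
  rw [hP E, mom]
  simp [hzero]

/-- **The three-family count with two double-difference blocks.**  `P, Q, R` pairwise cross-intersecting families
of subsets of `S` with no set in both `P` and `R`; `G` down-closed in `S` containing all within-family differences,
all cross meets and the outer double differences `X \ (Y ∪ Z)`, `Z \ (X ∪ Y)`.  Then `#P + #Q + #R ≤ #G`.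
(Theorem A′ + TRIPLE⁻.) -/
theorem card_add_card_add_card_le_of_blocks (S : Finset α) (G P Q R : Finset (Finset α))
    (hGS : ∀ E ∈ G, E ⊆ S) (hG : ∀ E ∈ G, ∀ F, F ⊆ E → F ∈ G)
    (hPS : ∀ U ∈ P, U ⊆ S) (hQS : ∀ U ∈ Q, U ⊆ S) (hRS : ∀ U ∈ R, U ⊆ S)
    (hPP : ∀ X ∈ P, ∀ X' ∈ P, X \ X' ∈ G) (hQQ : ∀ Y ∈ Q, ∀ Y' ∈ Q, Y \ Y' ∈ G)
    (hRR : ∀ Z ∈ R, ∀ Z' ∈ R, Z \ Z' ∈ G)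
    (hPQ : ∀ X ∈ P, ∀ Y ∈ Q, X ∩ Y ∈ G ∧ (X ∩ Y).Nonempty)
    (hQR : ∀ Y ∈ Q, ∀ Z ∈ R, Y ∩ Z ∈ G ∧ (Y ∩ Z).Nonempty)
    (hRP : ∀ Z ∈ R, ∀ X ∈ P, Z ∩ X ∈ G ∧ (Z ∩ X).Nonempty)
    (hDDP : ∀ X ∈ P, ∀ Y ∈ Q, ∀ Z ∈ R, X \ (Y ∪ Z) ∈ G)
    (hDDR : ∀ X ∈ P, ∀ Y ∈ Q, ∀ Z ∈ R, Z \ (X ∪ Y) ∈ G)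
    (hdisj : ∀ U ∈ P, U ∉ R) :
    #P + #Q + #R ≤ #G :=
  card_add_card_add_card_le_of_triple G hG P Q R hPP hQQ hRR hPQ hQR hRP
    (V_inf_V_inf_V_eq_bot_of_blocks S G P Q R hGS hG hPS hQS hRS hPP hRR (fun X hX Y hY => (hPQ X hX Y hY).1)
      (fun Y hY Z hZ => (hQR Y hY Z hZ).1) hDDP hDDR hdisj)

end ThreeFamilyRank

end Summit.CriticalPhenomena.PercolationContinuityZ3.Theorems
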